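import Summits.KontsevichZagierPeriods.KontsevichZagierPeriods.Theorems.RootDecompWalshStrataHtypeDescent

/-!
# Root decomposition (Walsh strata), part 53 — H-type fibre discriminants VIII: the generic line-edge family

The line-edge residual `R-HLx` of part 51 is the family of one-variable integrals

  `∫_S γ · Hi(x) · √P(x) · (κ₁ g − e κ₀ x)/H(x)² dx`,
  `H = e x² + g`, `Hi = (e/3) x³ + g x`, `P = H − m (κ₀ + κ₁ x)² = e′x² + f′x + g′`,
  `e′ = e − m κ₁²`, `f′ = −2 m κ₀ κ₁`, `g′ = g − m κ₀²`,

over semialgebraic `S ⊆ [0, 1] ∩ {H > 0} ∩ {P > 0}`.  This part CLOSES it for every NON-DEGENERATE radicand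
(`e′ · (4 e′ g′ − f′²) ≠ 0`) with the landed Euler terminals `InBaker.sqrt_rational` /
`InBaker.sqrt_rational_div` (EulerDescent11/12):

* `g > 0`: the denominator `H²` has no zero on the hull `[0, 1]` — `sqrt_rational` directly;
* `g ≤ 0`, vertex `x⋆ = √(−g/e)`: every point of `S` exceeds `x⋆`.  If the line does not vanish at the
  vertex (`κ₀ + κ₁ x⋆ ≠ 0`) then `P(x⋆) < 0`, so by continuity `S` keeps a definite distance from `x⋆` and a
  RATIONAL hull `[lo, 1]`, `lo > x⋆`, free of zeros of `H` exists — `sqrt_rational` again;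
* `κ₀ + κ₁ x⋆ = 0`: either the integrand vanishes identically, or `x⋆ = −κ₀/κ₁ =: ρ ∈ ℚ`, `g = −e ρ²`, and
  `P = (x − ρ) δ₁(x)`, `H = e (x − ρ)(x + ρ)`, `κ₁ g − e κ₀ x = e κ₁ ρ (x − ρ)`: the integrand is
  `(γ κ₁ ρ · Hi · δ₁ /(e (x + ρ)²)) / √P` — `sqrt_rational_div` on the hull `[0, 1]`.

The head becomes `quadricBakerDescent_of_residuals₆ : R-HLx° → R-HCx → R-Eθ → QuadricBakerDescent` with
`R-HLx°` = `R-HLx` restricted to the DEGENERATE radicands `e′ (4 e′ g′ − f′²) = 0` (a linear, constant or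
perfect-square radicand: `linear_factor` / `sqrt_const*` terminals after an `x ↦ x²` substitution — not done
here).

References: [KontsevichZagier2001 §1.2 rules (1)–(3)], [BCR1998 §2.2].
-/

noncomputable section

open Set MeasureTheory MvPolynomial Literature.NumberTheory.Transcendental
open Literature.ModelTheory.ExponentialFields (IsSemialgebraic isSemialgebraic_univ isSemialgebraic_empty)
open Summit.KontsevichZagierPeriods.RootDecompWalshStrata.ConicDescent.VertexChart

namespace Summit.KontsevichZagierPeriods.RootDecompWalshStrata.ConicDescent.BallCube

/-! #### 53.1 The Euler data of the line-edge family -/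

/-- Numerator `γ · ((e/3)X³ + gX) · (κ₁ g − e κ₀ X) ∈ ℚ[X]` of the line-edge integrand. [this node] -/
def hLxN (e g γ k0 k1 : ℚ) : Polynomial ℚ :=
  Polynomial.C γ * hPi e g * (Polynomial.C (k1 * g) - Polynomial.C (e * k0) * Polynomial.X)

/-- `hLxN(x) = γ (e x³/3 + g x)(κ₁ g − e κ₀ x)`. [bookkeeping] -/
theorem aeval_hLxN (e g γ k0 k1 : ℚ) (x : ℝ) :
    Polynomial.aeval x (hLxN e g γ k0 k1) =
      (γ : ℝ) * ((e : ℝ) / 3 * x ^ 3 + g * x) * ((k1 : ℝ) * g - e * k0 * x) := by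
  simp only [hLxN, map_mul, map_sub, Polynomial.aeval_C, Polynomial.aeval_X, eq_ratCast, aeval_hPi]

/-- Numerator `γ κ₁ ρ · ((e/3)X³ − e ρ² X) · ((e − m κ₁²) X + (e + m κ₁²) ρ)` of the vertex-line case
(`κ₀ = −κ₁ ρ`, `g = −e ρ²`). [this node] -/
def hLxNv (e m γ k1 ρ : ℚ) : Polynomial ℚ :=
  Polynomial.C (γ * k1 * ρ) * hPi e (-(e * ρ ^ 2)) *
    (Polynomial.C (e - m * k1 ^ 2) * Polynomial.X + Polynomial.C ((e + m * k1 ^ 2) * ρ))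

/-- `hLxNv(x) = γ κ₁ ρ (e x³/3 − e ρ² x)((e − m κ₁²) x + (e + m κ₁²) ρ)`. [bookkeeping] -/
theorem aeval_hLxNv (e m γ k1 ρ : ℚ) (x : ℝ) :
    Polynomial.aeval x (hLxNv e m γ k1 ρ) =
      (γ : ℝ) * k1 * ρ * ((e : ℝ) / 3 * x ^ 3 + -((e : ℝ) * ρ ^ 2) * x) *
        (((e : ℝ) - m * k1 ^ 2) * x + ((e : ℝ) + m * k1 ^ 2) * ρ) := by
  simp only [hLxNv, map_mul, map_add, Polynomial.aeval_C, Polynomial.aeval_X, eq_ratCast, aeval_hPi]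
  push_cast; ring

/-- Denominator `e (X + ρ)²` of the vertex-line case. [this node] -/
def hLxQv (e ρ : ℚ) : Polynomial ℚ := Polynomial.C e * (Polynomial.X + Polynomial.C ρ) ^ 2

/-- `hLxQv(x) = e (x + ρ)²`. [bookkeeping] -/
theorem aeval_hLxQv (e ρ : ℚ) (x : ℝ) :
    Polynomial.aeval x (hLxQv e ρ) = (e : ℝ) * (x + ρ) ^ 2 := by
  simp only [hLxQv, map_mul, map_pow, map_add, Polynomial.aeval_C, Polynomial.aeval_X, eq_ratCast]

/-- The line-edge radicand is the quadratic `qD (e − m κ₁²) (−2 m κ₀ κ₁) (g − m κ₀²)`. [bookkeeping] -/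
theorem hLx_rad (e g m k0 k1 : ℚ) (x : ℝ) :
    (e : ℝ) * x ^ 2 + g - m * ((k0 : ℝ) + k1 * x) ^ 2 =
      qD (e - m * k1 ^ 2) (-(2 * m * k0 * k1)) (g - m * k0 ^ 2) x := by
  simp only [qD]; push_cast; ring

/-! #### 53.2 The generic line-edge family -/

/-- **The line-edge family with non-degenerate radicand is in the Baker sector.**  For
`e′ (4 e′ g′ − f′²) ≠ 0` every member of `R-HLx` is an Euler terminal: `sqrt_rational` on the hull `[0, 1]`
(`g > 0`) or on a rational hull `[lo, 1]` beyond the vertex (`g ≤ 0`, line not through the vertex point), and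
`sqrt_rational_div` on `[0, 1]` when the line passes through the vertex point `(ρ, 0)`, `ρ = √(−g/e) ∈ ℚ`.
[KontsevichZagier2001 §1.2 rules (1)–(3); this node] -/
theorem InBaker.of_HLx_generic (e g m γ k0 k1 : ℚ) (he : 0 < e) (hm : 1 ≤ m)
    (hnd : (e - m * k1 ^ 2) * (4 * (e - m * k1 ^ 2) * (g - m * k0 ^ 2) - (2 * m * k0 * k1) ^ 2) ≠ 0)
    (S : Set (Fin 1 → ℝ)) (hS : IsSemialgebraic ℚ S)
    (hdom : ∀ t ∈ S, (0 ≤ t 0 ∧ t 0 ≤ 1) ∧ 0 < (e : ℝ) * t 0 ^ 2 + g ∧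
      (m : ℝ) * ((k0 : ℝ) + k1 * t 0) ^ 2 < (e : ℝ) * t 0 ^ 2 + g)
    (r : KZ.IntegralRep 1) (hrd : r.domain = S)
    (hri : EqOn r.integrand (fun t => (γ : ℝ) * ((e : ℝ) / 3 * t 0 ^ 3 + g * t 0) *
      √((e : ℝ) * t 0 ^ 2 + g - m * ((k0 : ℝ) + k1 * t 0) ^ 2) *
      (((k1 : ℝ) * g - e * k0 * t 0) / ((e : ℝ) * t 0 ^ 2 + g) ^ 2)) S) :
    InBaker (KZ.of r) := by
  have _hS := hS
  subst hrd
  have he0 : (0 : ℝ) < e := by exact_mod_cast he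
  have hm0 : (0 : ℝ) < m := by exact_mod_cast zero_lt_one.trans_le hm
  have he' : e - m * k1 ^ 2 ≠ 0 := left_ne_zero_of_mul hnd
  have hh : g - m * k0 ^ 2 - (-(2 * m * k0 * k1)) ^ 2 / (4 * (e - m * k1 ^ 2)) ≠ 0 := by
    intro h0
    apply hnd
    have h1 : 4 * (e - m * k1 ^ 2) * (g - m * k0 ^ 2) - (2 * m * k0 * k1) ^ 2 =
        4 * (e - m * k1 ^ 2) * (g - m * k0 ^ 2 - (-(2 * m * k0 * k1)) ^ 2 / (4 * (e - m * k1 ^ 2))) := by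
      field_simp
    rw [h1, h0, mul_zero, mul_zero]
  -- the integrand in Euler form `N/H² · √qD`
  have hri' : EqOn r.integrand (fun v => Polynomial.aeval (v 0) (hLxN e g γ k0 k1) /
      Polynomial.aeval (v 0) (hP e g ^ 2) *
        √(qD (e - m * k1 ^ 2) (-(2 * m * k0 * k1)) (g - m * k0 ^ 2) (v 0))) r.domain := by
    intro v hv
    rw [hri hv]
    dsimp only
    rw [hLx_rad, aeval_hLxN, map_pow, aeval_hP]
    ring
  have hI01 : ∀ v ∈ r.domain, ((0 : ℚ) : ℝ) ≤ v 0 ∧ v 0 ≤ ((1 : ℚ) : ℝ) := fun v hv => by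
    obtain ⟨⟨h0, h1⟩, -⟩ := hdom v hv
    exact ⟨by exact_mod_cast h0, by exact_mod_cast h1⟩
  rcases lt_or_ge 0 g with hg | hg
  · -- `g > 0`: hull `[0, 1]`
    have hg0 : (0 : ℝ) < g := by exact_mod_cast hg
    refine InBaker.sqrt_rational _ _ _ he' hh _ _ 0 1 (fun x hx _ => ?_) r hI01 hri'
    have hx0 : (0 : ℝ) ≤ x := by exact_mod_cast hx
    rw [map_pow, aeval_hP]
    exact pow_ne_zero 2 (add_pos_of_nonneg_of_pos (mul_nonneg he0.le (sq_nonneg x)) hg0).ne'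
  · -- `g ≤ 0`: the vertex `x⋆ = √(-g/e)` lies below every point of the domain
    have hg0 : (g : ℝ) ≤ 0 := by exact_mod_cast hg
    obtain ⟨xs, hxs⟩ : ∃ xs : ℝ, xs = √(-(g : ℝ) / e) := ⟨_, rfl⟩
    have hxs0 : 0 ≤ xs := by rw [hxs]; exact Real.sqrt_nonneg _
    have hxs2 : xs ^ 2 = -(g : ℝ) / e := by
      rw [hxs, Real.sq_sqrt (div_nonneg (neg_nonneg.2 hg0) he0.le)]
    have hexs : (e : ℝ) * xs ^ 2 + g = 0 := by
      rw [hxs2]; field_simp; ring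
    have hgt : ∀ v ∈ r.domain, xs < v 0 := fun v hv => by
      obtain ⟨⟨h0, -⟩, hH, -⟩ := hdom v hv
      have hv0 : 0 < v 0 := lt_of_le_of_ne h0 fun h => by
        rw [← h] at hH; norm_num at hH; linarith
      rw [hxs, Real.sqrt_lt' hv0, div_lt_iff₀ he0]
      nlinarith
    by_cases hlam : (k0 : ℝ) + k1 * xs = 0
    · -- the line vanishes at the vertex point
      rcases eq_or_ne k1 0 with hk1 | hk1
      · -- `κ₁ = 0`, hence `κ₀ = 0`: the integrand vanishes identically
        subst hk1
        have hk0 : (k0 : ℝ) = 0 := by simpa using hlam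
        have hk0' : k0 = 0 := by exact_mod_cast hk0
        subst hk0'
        exact InBaker.of_eqOn_ratCast r 0 fun v hv => by rw [hri hv]; simp
      · -- `κ₁ ≠ 0`: `x⋆ = -κ₀/κ₁ =: ρ` is rational and `g = -e ρ²`
        obtain ⟨ρ, hρ⟩ : ∃ ρ : ℚ, k0 = -(k1 * ρ) := ⟨-k0 / k1, by field_simp⟩
        subst hρ
        have hk1r : (k1 : ℝ) ≠ 0 := by exact_mod_cast hk1
        have hxsρ : xs = ρ := by
          push_cast at hlam
          have h1 : (k1 : ℝ) * (xs - ρ) = 0 := by linarith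
          rcases mul_eq_zero.1 h1 with h2 | h2
          · exact absurd h2 hk1r
          · linarith
        subst hxsρ
        have hgρr : (g : ℝ) = -(e * ρ ^ 2) := by
          have h1 := hxs2
          field_simp at h1
          linarith
        have hgρ : g = -(e * ρ ^ 2) := by exact_mod_cast hgρr
        subst hgρ
        rcases eq_or_ne ρ 0 with hρ0 | hρ0
        · -- `ρ = 0`: `κ₀ = g = 0`, the integrand vanishes identically
          subst hρ0
          exact InBaker.of_eqOn_ratCast r 0 fun v hv => by rw [hri hv]; simp
        · have hρpos : (0 : ℝ) < ρ := lt_of_le_of_ne hxs0 (Ne.symm (by exact_mod_cast hρ0))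
          refine InBaker.sqrt_rational_div _ _ _ he' hh (hLxNv e m γ k1 ρ) (hLxQv e ρ) 0 1
            (fun x hx _ => ?_) r hI01 fun v hv => ?_
          · have hx0 : (0 : ℝ) ≤ x := by exact_mod_cast hx
            rw [aeval_hLxQv]
            positivity
          · obtain ⟨⟨h0, -⟩, hH, hP⟩ := hdom v hv
            have hpos : 0 < qD (e - m * k1 ^ 2) (-(2 * m * -(k1 * ρ) * k1))
                (-(e * ρ ^ 2) - m * (-(k1 * ρ)) ^ 2) (v 0) := by
              rw [← hLx_rad]; linarith
            obtain ⟨w, hw⟩ : ∃ w : ℝ, w = √(qD (e - m * k1 ^ 2) (-(2 * m * -(k1 * ρ) * k1))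
                (-(e * ρ ^ 2) - m * (-(k1 * ρ)) ^ 2) (v 0)) := ⟨_, rfl⟩
            have hw0 : w ≠ 0 := by rw [hw]; exact (Real.sqrt_pos.2 hpos).ne'
            have hw2 : w ^ 2 = (((e - m * k1 ^ 2 : ℚ)) : ℝ) * v 0 ^ 2 +
                ((-(2 * m * -(k1 * ρ) * k1) : ℚ) : ℝ) * v 0 +
                ((-(e * ρ ^ 2) - m * (-(k1 * ρ)) ^ 2 : ℚ) : ℝ) := by
              rw [hw, Real.sq_sqrt hpos.le]; rfl
            have hB : ((e : ℝ) * v 0 ^ 2 + ((-(e * ρ ^ 2) : ℚ) : ℝ)) ^ 2 ≠ 0 := pow_ne_zero 2 hH.ne'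
            have hB' : (e : ℝ) * (v 0 + ρ) ^ 2 ≠ 0 := by positivity
            rw [hri' hv]
            dsimp only
            rw [← hw, aeval_hLxN, map_pow, aeval_hP, aeval_hLxNv, aeval_hLxQv, div_mul_eq_mul_div,
              div_div, div_eq_div_iff hB (mul_ne_zero hB' hw0)]
            push_cast at hw2 ⊢
            linear_combination ((γ : ℝ) * ((e : ℝ) / 3 * v 0 ^ 3 + -((e : ℝ) * ρ ^ 2) * v 0) *
              ((k1 : ℝ) * -((e : ℝ) * ρ ^ 2) - e * -((k1 : ℝ) * ρ) * v 0) *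
              ((e : ℝ) * (v 0 + ρ) ^ 2)) * hw2
    · -- the line does not vanish at the vertex point: `P(x⋆) < 0`, and `S` stays away from `x⋆`
      have hPxs : (e : ℝ) * xs ^ 2 + g - m * ((k0 : ℝ) + k1 * xs) ^ 2 < 0 := by
        have h2 : 0 < ((k0 : ℝ) + k1 * xs) ^ 2 :=
          lt_of_le_of_ne (sq_nonneg _) (Ne.symm (pow_ne_zero 2 hlam))
        nlinarith [mul_pos hm0 h2]
      have hcont : Continuous fun x : ℝ => (e : ℝ) * x ^ 2 + g - m * ((k0 : ℝ) + k1 * x) ^ 2 := by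
        fun_prop
      obtain ⟨ε, hε, hball⟩ := Metric.eventually_nhds_iff.1
        (hcont.continuousAt.eventually_lt continuousAt_const hPxs)
      obtain ⟨lo, hlo1, hlo2⟩ := exists_rat_btwn (show xs < xs + ε by linarith)
      have hge : ∀ v ∈ r.domain, xs + ε ≤ v 0 := fun v hv => by
        obtain ⟨-, -, hP⟩ := hdom v hv
        refine not_lt.1 fun hlt => ?_
        have hd : dist (v 0) xs < ε := by
          rw [Real.dist_eq, abs_of_pos (sub_pos.2 (hgt v hv))]; linarith
        have h1 := hball hd
        linarith
      refine InBaker.sqrt_rational _ _ _ he' hh _ _ lo 1 (fun x hx _ => ?_) r (fun v hv => ?_) hri'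
      · rw [map_pow, aeval_hP]
        have hx0 : xs < x := by linarith
        have h1 : xs ^ 2 < x ^ 2 := by nlinarith
        rw [hxs2, div_lt_iff₀ he0] at h1
        exact pow_ne_zero 2 (show (0 : ℝ) < e * x ^ 2 + g by nlinarith).ne'
      · obtain ⟨⟨-, h1⟩, -⟩ := hdom v hv
        exact ⟨by linarith [hge v hv], by exact_mod_cast h1⟩

/-! #### 53.3 The line-edge residual reduced to its degenerate radicands -/

/-- **`R-HLx` from its degenerate part `R-HLx°`.**  `R-HLx°` is `R-HLx` restricted to the radicands with
`e′ (4 e′ g′ − f′²) = 0` (`e′ = e − m κ₁²`, `f′ = −2 m κ₀ κ₁`, `g′ = g − m κ₀²`): a linear, a constant or a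
perfect-square radicand.  Everything else is `InBaker.of_HLx_generic`. [this node] -/
theorem InBaker.of_Hlines_x
    (hdeg : (∀ (e g m γ k0 k1 : ℚ), 0 < e → 1 ≤ m →
      (e - m * k1 ^ 2) * (4 * (e - m * k1 ^ 2) * (g - m * k0 ^ 2) - (2 * m * k0 * k1) ^ 2) = 0 →
      ∀ (S : Set (Fin 1 → ℝ)), IsSemialgebraic ℚ S →
        (∀ t ∈ S, (0 ≤ t 0 ∧ t 0 ≤ 1) ∧ 0 < (e : ℝ) * t 0 ^ 2 + g ∧
          (m : ℝ) * ((k0 : ℝ) + k1 * t 0) ^ 2 < (e : ℝ) * t 0 ^ 2 + g) →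
        ∀ r : KZ.IntegralRep 1, r.domain = S →
          EqOn r.integrand (fun t => (γ : ℝ) * ((e : ℝ) / 3 * t 0 ^ 3 + g * t 0) *
            √((e : ℝ) * t 0 ^ 2 + g - m * ((k0 : ℝ) + k1 * t 0) ^ 2) *
            (((k1 : ℝ) * g - e * k0 * t 0) / ((e : ℝ) * t 0 ^ 2 + g) ^ 2)) S →
          InBaker (KZ.of r))) :
    (∀ (e g m γ k0 k1 : ℚ), 0 < e → 1 ≤ m →
      ∀ (S : Set (Fin 1 → ℝ)), IsSemialgebraic ℚ S →
        (∀ t ∈ S, (0 ≤ t 0 ∧ t 0 ≤ 1) ∧ 0 < (e : ℝ) * t 0 ^ 2 + g ∧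
          (m : ℝ) * ((k0 : ℝ) + k1 * t 0) ^ 2 < (e : ℝ) * t 0 ^ 2 + g) →
        ∀ r : KZ.IntegralRep 1, r.domain = S →
          EqOn r.integrand (fun t => (γ : ℝ) * ((e : ℝ) / 3 * t 0 ^ 3 + g * t 0) *
            √((e : ℝ) * t 0 ^ 2 + g - m * ((k0 : ℝ) + k1 * t 0) ^ 2) *
            (((k1 : ℝ) * g - e * k0 * t 0) / ((e : ℝ) * t 0 ^ 2 + g) ^ 2)) S →
          InBaker (KZ.of r)) := by
  intro e g m γ k0 k1 he hm S hS hdom r hrd hri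
  by_cases hnd : (e - m * k1 ^ 2) * (4 * (e - m * k1 ^ 2) * (g - m * k0 ^ 2) - (2 * m * k0 * k1) ^ 2) = 0
  · exact hdeg e g m γ k0 k1 he hm hnd S hS hdom r hrd hri
  · exact InBaker.of_HLx_generic e g m γ k0 k1 he hm hnd S hS hdom r hrd hri

/-! #### 53.4 The descent from the reduced residuals -/

/-- **`QuadricBakerDescent` from the reduced one-variable residual families** (this node, generation 9,
final form).  The three hypotheses are, in order:
* `R-HLx°` — the DEGENERATE line-edge family: `∫ γ (e x³/3 + g x) √P (κ₁ g − e κ₀ x)/(e x² + g)² dx`,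
  `P = e x² + g − m (κ₀ + κ₁ x)²`, over semialgebraic subsets of `[0, 1] ∩ {e x² + g > 0} ∩ {P > 0}`,
  ONLY for the radicands with `(e − m κ₁²)(4 (e − m κ₁²)(g − m κ₀²) − (2 m κ₀ κ₁)²) = 0` (linear, constant
  or perfect-square `P`; the generic radicands are closed in part 53);
* `R-HCx` — the conic-edge family of part 52;
* `R-Eθ` — the E-type corner atoms of part 43.
[KontsevichZagier2001 §1.2; this node] -/
theorem quadricBakerDescent_of_residuals₆
    (hx : (∀ (e g m γ k0 k1 : ℚ), 0 < e → 1 ≤ m →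
      (e - m * k1 ^ 2) * (4 * (e - m * k1 ^ 2) * (g - m * k0 ^ 2) - (2 * m * k0 * k1) ^ 2) = 0 →
      ∀ (S : Set (Fin 1 → ℝ)), IsSemialgebraic ℚ S →
        (∀ t ∈ S, (0 ≤ t 0 ∧ t 0 ≤ 1) ∧ 0 < (e : ℝ) * t 0 ^ 2 + g ∧
          (m : ℝ) * ((k0 : ℝ) + k1 * t 0) ^ 2 < (e : ℝ) * t 0 ^ 2 + g) →
        ∀ r : KZ.IntegralRep 1, r.domain = S →
          EqOn r.integrand (fun t => (γ : ℝ) * ((e : ℝ) / 3 * t 0 ^ 3 + g * t 0) *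
            √((e : ℝ) * t 0 ^ 2 + g - m * ((k0 : ℝ) + k1 * t 0) ^ 2) *
            (((k1 : ℝ) * g - e * k0 * t 0) / ((e : ℝ) * t 0 ^ 2 + g) ^ 2)) S →
          InBaker (KZ.of r)))
    (hc : (∀ (e g m γ q0 q1 q2 s : ℚ), 0 < e → 1 ≤ m → (s = 1 ∨ s = -1) →
      ∀ (S : Set (Fin 1 → ℝ)), IsSemialgebraic ℚ S →
        (∀ t ∈ S, (0 ≤ t 0 ∧ t 0 ≤ 1) ∧ 0 < (e : ℝ) * t 0 ^ 2 + g ∧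
          0 < ((m : ℝ) + q2 ^ 2) * ((e : ℝ) * t 0 ^ 2 + g) - m * ((q0 : ℝ) + q1 * t 0) ^ 2) →
        ∀ r : KZ.IntegralRep 1, r.domain = S →
          EqOn r.integrand (fun t => (γ : ℝ) * ((e : ℝ) / 3 * t 0 ^ 3 + g * t 0) * ((q1 : ℝ) * g - e * q0 * t 0) *
            ((m : ℝ) * ((q0 : ℝ) + q1 * t 0) +
              s * q2 * √(((m : ℝ) + q2 ^ 2) * ((e : ℝ) * t 0 ^ 2 + g) - m * ((q0 : ℝ) + q1 * t 0) ^ 2)) ^ 2 /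
            (((e : ℝ) * t 0 ^ 2 + g) ^ 2 *
              √(((m : ℝ) + q2 ^ 2) * ((e : ℝ) * t 0 ^ 2 + g) - m * ((q0 : ℝ) + q1 * t 0) ^ 2))) S →
          InBaker (KZ.of r)))
    (hθ : (∀ (L : Quadric₃) (ℓ₁ ℓ₂ g : Wall) (γ : ℚ) (σ : Fin 6 → SignType) (r : KZ.IntegralRep 2),
      0 < L.dq.disc →
      ¬((L.bwall ℓ₁).precomp L.dq.lagM.inv ∈ goodWalls 1 L.dq.eκ L.dq.d11 L.dq.cst ∧
          (L.bwall ℓ₂).precomp L.dq.lagM.inv ∈ goodWalls 1 L.dq.eκ L.dq.d11 L.dq.cst) →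
      r.domain = atomFam (L.wfam ℓ₁ ℓ₂ g) σ →
      EqOn r.integrand (fun v => (γ : ℝ) * √(L.Dxy (v 0) (v 1))) r.domain → InBaker (KZ.of r))) :
    Summit.KontsevichZagierPeriods.KontsevichZagierPeriods.Theses.RootDecompWalshStrata.QuadricBakerDescent :=
  quadricBakerDescent_of_residuals₅ (InBaker.of_Hlines_x hx) hc hθ

end Summit.KontsevichZagierPeriods.RootDecompWalshStrata.ConicDescent.BallCube
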